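import Literature.Topology.FourManifolds.CobordismAttachment
import Literature.Topology.FourManifolds.InteriorLift
import Literature.Topology.FourManifolds.CollarShrink
import Literature.Topology.FourManifolds.OpenCollarExistence
import Literature.Topology.FourManifolds.SmoothEmbeddingComp
import Literature.Topology.FourManifolds.CerfGammaFourProofs
import Mathlib.Geometry.Manifold.Instances.Icc
import HarnessLib

/-!
# A manifold with boundary is the attachment of a product cobordism to itself along a collar

Topic `Literature/Topology/FourManifolds`; a complement to `CobordismAttachment.lean`.
Everything here is PROVED; no named facts.

Let `W` be a compact smooth `(n+2)`-manifold with boundary datum `b`, and let `Y` be a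
cobordism from `M` to `M` which is a **product relative to both end markings**: a
diffeomorphism `Θ : Y ≅ M × [0, 1]` with `Θ (inl x) = (x, 0)`, `Θ (inr x) = (x, 1)`
(`Cobordism.IsTrivialRelEnds`, e.g. the composite `X ∪_N X′` of an invertible cobordism and its
inverse, Akbulut–Ruberman (2016), Def. 2.1).  Then, for every `ψ : ∂W ≅ M`, **`W` itself is a
witness of the attachment `W ∪_ψ Y`** (`CobordismAttachment b Y ψ W`) whose far end is the given
boundary of `W`, MARKED THROUGH `ψ⁻¹`:

* the piece `W` is pushed into itself along a long open collar `C` of `∂W` by the shrink map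
  of `CollarShrink.lean` (`z ↦ z` off the collar, `C x t ↦ C x (σ t)`, so `∂W ↦ level c`);
* the piece `Y ≅ M × [0, 1]` is laid into the collar slab of heights `[0, c]` upside down:
  `y ↦ C (ψ⁻¹ (pr₁ Θ y)) (c · (1 - pr₂ Θ y))`, so that `inl m ↦ level c` (the seam) and
  `inr m ↦ b.incl (ψ⁻¹ m)` (the boundary).

Main result: `CobordismAttachment.referenceAttachment C ψ Θ h₀ h₁ : CobordismAttachment b Y ψ W`
with `referenceAttachment_jX_inr : jX (Y.inr m) = b.incl (ψ.symm m)`.  This is the standard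
picture "`W ∪_∂ (∂W × I) ≅ W`" (Milnor, *Lectures on the h-cobordism theorem* (1965), §1, after
Thm. 1.4; Kosinski (1993), VI.5), in the witness style of the tree; combined with the uniqueness
of attachments (`CobordismAttachmentUniqueness.lean`) it identifies ANY witness of `W ∪_ψ Y`
with `W` relative to the far end.  Used in the discharge of
`Literature.Barriers.SmoothPoincare4.akbulutRuberman2016_relativelyExotic` (Akbulut–Ruberman
(2016), §3: "`X̄ ∪_N X ≅ N × I` … and hence …").

Smoothness of the upside-down piece: off the incoming end it is a partial diffeomorphism onto
the open collar slab (`slabHomeo`); near the incoming end it is the shrink map (an immersion at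
the boundary, `isSmoothEmbedding_shrinkTo`) precomposed with a partial diffeomorphism of `Y`
onto a neighbourhood of `∂W` (`footHomeo`) and postcomposed with the reflection of the open
collar in the level `c` (`reflHomeo`).

## References

* J. Milnor, *Lectures on the h-cobordism theorem*, Princeton (1965), §1. [MilnorHCobordism1965]
* A. Kosinski, *Differential Manifolds* (1993), Ch. VI §5. [Kosinski1993]
* S. Akbulut, D. Ruberman, Comment. Math. Helv. 91 (2016), Def. 2.1, §3. [AkbulutRuberman2016]
-/

open scoped Manifold ContDiff Topology
open Set Function Filter Topology

noncomputable section

namespace Literature.Topology.FourManifolds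

universe u

/-- Local notation: `𝔼 n` is the model Euclidean space `EuclideanSpace ℝ (Fin n)`. -/
local notation "𝔼 " n:arg => EuclideanSpace ℝ (Fin n)
/-- Local notation: `ℍ n` is the closed half space `EuclideanHalfSpace n`. -/
local notation "ℍ " n:arg => EuclideanHalfSpace n

/-! ### Postcomposition of an immersion with a partial diffeomorphism -/

section PostComp

open _root_.OpenPartialHomeomorph

variable {EM : Type*} [NormedAddCommGroup EM] [NormedSpace ℝ EM] {HM : Type*} [TopologicalSpace HM]
  {I : ModelWithCorners ℝ EM HM} {EN : Type*} [NormedAddCommGroup EN] [NormedSpace ℝ EN]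
  {HN : Type*} [TopologicalSpace HN] {J : ModelWithCorners ℝ EN HN}
  {F : Type*} [NormedAddCommGroup F] [NormedSpace ℝ F]
  {M : Type*} [TopologicalSpace M] [ChartedSpace HM M]
  {N : Type*} [TopologicalSpace N] [ChartedSpace HN N]
  {N' : Type*} [TopologicalSpace N'] [ChartedSpace HN N']
  {f : M → N} {x : M}

/-- An immersion postcomposed with a partial diffeomorphism (same model on `N`, `N′`) is an
immersion, same complement (chart `Ψ.symm ≫ codChart`, domain chart restricted to
`f ⁻¹' Ψ.source`).  Copied from `CorkDecompositionSplittingProof.lean` (kept private here to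
avoid importing that file). [folklore] -/
private theorem postcomp_openPartialHomeomorph [IsManifold I ∞ M] [IsManifold J ∞ N']
    (hf : Manifold.IsImmersionAtOfComplement F I J ∞ f x) (Ψ : OpenPartialHomeomorph N N')
    (hΨ : ContMDiffOn J J ∞ Ψ Ψ.source) (hΨ' : ContMDiffOn J J ∞ Ψ.symm Ψ.target)
    (hfx : f x ∈ Ψ.source) :
    Manifold.IsImmersionAtOfComplement F I J ∞ (Ψ ∘ f) x := by
  set s : Set M := hf.domChart.source ∩ f ⁻¹' Ψ.source with hs
  have hso : IsOpen s := hf.continuousOn.isOpen_inter_preimage hf.domChart.open_source Ψ.open_source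
  have hxs : x ∈ s := ⟨hf.mem_domChart_source, hfx⟩
  have hdom : hf.domChart.restr s ∈ IsManifold.maximalAtlas I ∞ M :=
    restr_mem_maximalAtlas _ hf.domChart_mem_maximalAtlas hso
  have hcod : Ψ.symm ≫ₕ hf.codChart ∈ IsManifold.maximalAtlas J ∞ N' := by
    apply OpenPartialHomeomorph.mem_maximalAtlas_of_contMDiffOn
    · rw [trans_source, coe_trans]
      exact (contMDiffOn_of_mem_maximalAtlas hf.codChart_mem_maximalAtlas).comp
        (hΨ'.mono inter_subset_left) fun z hz => hz.2
    · rw [trans_symm_eq_symm_trans_symm, trans_target, coe_trans, symm_symm]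
      refine hΨ.comp
        ((contMDiffOn_symm_of_mem_maximalAtlas hf.codChart_mem_maximalAtlas).mono
          inter_subset_left) (fun z hz => ?_)
      have := hz.2
      simp only [mem_preimage, symm_target] at this
      exact this
  have hcont : ContinuousAt (Ψ ∘ f) x :=
    ((hΨ.continuousOn.continuousWithinAt hfx).continuousAt (Ψ.open_source.mem_nhds hfx)).comp
      hf.continuousAt
  refine Manifold.IsImmersionAtOfComplement.mk_of_continuousAt hcont hf.equiv
    (hf.domChart.restr s) (Ψ.symm ≫ₕ hf.codChart) ?_ ?_ hdom hcod ?_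
  · rw [hf.domChart.restr_source' _ hso]; exact ⟨hf.mem_domChart_source, hxs⟩
  · simp only [trans_source, symm_source, mem_inter_iff, mem_preimage, comp_apply]
    exact ⟨Ψ.map_source hfx, by rw [Ψ.left_inv hfx]; exact hf.mem_codChart_source⟩
  · intro u hu
    have hu' : u ∈ (hf.domChart.extend I).target := by
      simp only [extend_target, restr_target, mem_inter_iff, mem_preimage, hso.interior_eq] at hu ⊢
      exact ⟨hu.1.1, hu.2⟩
    have hmem : hf.domChart.symm (I.symm u) ∈ s := by
      simp only [extend_target, restr_target, mem_inter_iff, mem_preimage, hso.interior_eq] at hu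
      exact hu.1.2
    have h := hf.writtenInCharts hu'
    simp only [comp_apply, extend_coe, extend_coe_symm, coe_trans, restr_symm_apply] at h ⊢
    rw [Ψ.left_inv hmem.2]
    exact h

/-- The coercion partial homeomorphism `U ⇀ M` of an open subset is smooth (copied from
`CorkDecompositionSplittingProof.lean`). [folklore] -/
private theorem contMDiffOn_subtypeCoe (U : TopologicalSpace.Opens M) (hU : Nonempty U) :
    ContMDiffOn I I ∞ (U.openPartialHomeomorphSubtypeCoe hU)
      (U.openPartialHomeomorphSubtypeCoe hU).source := by
  rw [TopologicalSpace.Opens.openPartialHomeomorphSubtypeCoe_source]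
  exact (contMDiff_subtype_val.contMDiffOn (s := univ)).congr fun z _ => by simp

/-- Its inverse is smooth on `U` (copied from `CorkDecompositionSplittingProof.lean`).
[folklore] -/
private theorem contMDiffOn_subtypeCoe_symm (U : TopologicalSpace.Opens M) (hU : Nonempty U) :
    ContMDiffOn I I ∞ (U.openPartialHomeomorphSubtypeCoe hU).symm
      (U.openPartialHomeomorphSubtypeCoe hU).target := by
  set c := U.openPartialHomeomorphSubtypeCoe hU
  have key : EqOn (Subtype.val ∘ c.symm) id c.target := fun w hw => c.right_inv hw
  intro z hz
  have h1 : ContMDiffWithinAt I I ∞ (Subtype.val ∘ c.symm) c.target z :=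
    contMDiffWithinAt_id.congr key (key hz)
  exact (ContMDiffWithinAt.subtypeVal_comp_iff U _ _ _).1 h1

end PostComp

/-! ### The reference attachment of a product cobordism -/

namespace CobordismAttachment

open CollarShrink BoundaryData.OpenCollar

section Reference

variable {n : ℕ} {W : Type u} [TopologicalSpace W] [ChartedSpace (ℍ (n + 1 + 1)) W]
  {b : BoundaryData (𝓡∂ (n + 1 + 1)) W (𝓡 (n + 1))} (C : b.OpenCollar)
  {M : Type u} [TopologicalSpace M] [ChartedSpace (𝔼 (n + 1)) M]
  (ψ : b.carrier ≃ₘ⟮𝓡 (n + 1), 𝓡 (n + 1)⟯ M) {Y : Cobordism (n + 1) M M}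
  (Θ : Y.W ≃ₘ⟮𝓡∂ (n + 1 + 1), (𝓡 (n + 1)).prod (𝓡∂ 1)⟯ (M × Set.Icc (0 : ℝ) 1))

/-- The level function `pr₂ ∘ Θ : Y → [0, 1]`, as a real number. [folklore] -/
def lev (y : Y.W) : ℝ := ((Θ y).2 : ℝ)

/-- The base function `pr₁ ∘ Θ : Y → M`. [folklore] -/
def bas (y : Y.W) : M := (Θ y).1

/-- The level is nonnegative. [folklore] -/
theorem lev_nonneg (y : Y.W) : 0 ≤ lev Θ y := (Θ y).2.2.1

/-- The level is at most `1`. [folklore] -/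
theorem lev_le_one (y : Y.W) : lev Θ y ≤ 1 := (Θ y).2.2.2

/-- The level lies in `[0, 1]`. [folklore] -/
theorem lev_mem (y : Y.W) : lev Θ y ∈ Icc (0 : ℝ) 1 := (Θ y).2.2

/-- Reconstructing `y` from its base and level. [folklore] -/
theorem symm_bas_lev (y : Y.W) : Θ.symm (bas Θ y, ⟨lev Θ y, lev_mem Θ y⟩) = y := by
  have : (bas Θ y, (⟨lev Θ y, lev_mem Θ y⟩ : Icc (0 : ℝ) 1)) = Θ y := rfl
  rw [this, Diffeomorph.symm_apply_apply]

/-- The level function is `C^∞`. [folklore] -/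
theorem contMDiff_lev [IsManifold (𝓡 (n + 1)) ∞ M] : ContMDiff (𝓡∂ (n + 1 + 1)) 𝓘(ℝ, ℝ) ∞ (lev Θ) :=
  contMDiff_subtype_coe_Icc.comp (contMDiff_snd.comp Θ.contMDiff)

/-- The base function is `C^∞`. [folklore] -/
theorem contMDiff_bas [IsManifold (𝓡 (n + 1)) ∞ M] : ContMDiff (𝓡∂ (n + 1 + 1)) (𝓡 (n + 1)) ∞ (bas Θ) :=
  contMDiff_fst.comp Θ.contMDiff

/-- The level function is continuous. [folklore] -/
theorem continuous_lev [IsManifold (𝓡 (n + 1)) ∞ M] : Continuous (lev Θ) := (contMDiff_lev Θ).continuous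

/-- The base function is continuous. [folklore] -/
theorem continuous_bas [IsManifold (𝓡 (n + 1)) ∞ M] : Continuous (bas Θ) := (contMDiff_bas Θ).continuous

/-- **The upside-down piece**: `y ↦ C (ψ⁻¹ (pr₁ Θ y)) (c · (1 - pr₂ Θ y))`. [folklore] -/
def jYref (y : Y.W) : W := C.toFun (ψ.symm (bas Θ y)) (shrinkConst * (1 - lev Θ y))

/-- The height parameter of the upside-down piece is nonnegative. [folklore] -/
theorem param_nonneg (y : Y.W) : 0 ≤ shrinkConst * (1 - lev Θ y) :=
  mul_nonneg shrinkConst_pos.le (by linarith [lev_le_one Θ y])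

/-- The height parameter is at most `c`. [folklore] -/
theorem param_le (y : Y.W) : shrinkConst * (1 - lev Θ y) ≤ shrinkConst := by
  have := lev_nonneg Θ y
  nlinarith [shrinkConst_pos]

/-- The upside-down piece lands in the collar region. [folklore] -/
theorem jYref_mem_region (y : Y.W) : jYref C ψ Θ y ∈ C.region := C.mem_region _ _ (param_nonneg Θ y)

/-- The height of the upside-down piece. [folklore] -/
theorem height_jYref (y : Y.W) : C.height (jYref C ψ Θ y) = shrinkConst * (1 - lev Θ y) :=
  C.height_apply _ _ (param_nonneg Θ y)

/-- The projection of the upside-down piece. [folklore] -/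
theorem proj_jYref (y : Y.W) : C.proj (jYref C ψ Θ y) = ψ.symm (bas Θ y) :=
  C.proj_apply _ _ (param_nonneg Θ y)

/-- The upside-down piece is `C^∞`. [folklore] -/
theorem contMDiff_jYref [IsManifold (𝓡 (n + 1)) ∞ M] :
    ContMDiff (𝓡∂ (n + 1 + 1)) (𝓡∂ (n + 1 + 1)) ∞ (jYref C ψ Θ) := by
  have h1 : ContMDiff (𝓡∂ (n + 1 + 1)) ((𝓡 (n + 1)).prod 𝓘(ℝ, ℝ)) ∞
      (fun y => (ψ.symm (bas Θ y), shrinkConst * (1 - lev Θ y))) :=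
    (ψ.symm.contMDiff.comp (contMDiff_bas Θ)).prodMk
      (contMDiff_const.mul (contMDiff_const.sub (contMDiff_lev Θ)))
  exact C.contMDiffOn_toFun.comp_contMDiff h1 fun y => ⟨mem_univ _, param_nonneg Θ y⟩

/-- The upside-down piece is continuous. [folklore] -/
theorem continuous_jYref [IsManifold (𝓡 (n + 1)) ∞ M] : Continuous (jYref C ψ Θ) :=
  (contMDiff_jYref C ψ Θ).continuous

/-- The upside-down piece is injective. [folklore] -/
theorem injective_jYref : Injective (jYref C ψ Θ) := by
  intro y y' h
  obtain ⟨h1, h2⟩ := C.eq_of_apply_eq (param_nonneg Θ y) (param_nonneg Θ y') h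
  have hb : bas Θ y = bas Θ y' := ψ.symm.injective h1
  have hl : lev Θ y = lev Θ y' := by
    have hc := shrinkConst_pos
    have : 1 - lev Θ y = 1 - lev Θ y' := mul_left_cancel₀ hc.ne' h2
    linarith
  rw [← symm_bas_lev Θ y, ← symm_bas_lev Θ y']
  congr 3

variable (h₀ : ∀ x, Θ (Y.inl x) = (x, ⊥)) (h₁ : ∀ x, Θ (Y.inr x) = (x, ⊤))

include h₀ in
/-- The incoming end has level `0`. [folklore] -/
theorem lev_inl (x : M) : lev Θ (Y.inl x) = 0 := by
  simp only [lev, h₀ x]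
  rfl

include h₀ in
/-- The base of an incoming end point. [folklore] -/
theorem bas_inl (x : M) : bas Θ (Y.inl x) = x := by
  simp only [bas, h₀ x]

include h₁ in
/-- The far end has level `1`. [folklore] -/
theorem lev_inr (x : M) : lev Θ (Y.inr x) = 1 := by
  simp only [lev, h₁ x]
  rfl

include h₁ in
/-- The base of a far end point. [folklore] -/
theorem bas_inr (x : M) : bas Θ (Y.inr x) = x := by
  simp only [bas, h₁ x]

include h₀ in
/-- **The incoming end goes to the seam level `c`.** [folklore] -/
theorem jYref_inl (x : M) : jYref C ψ Θ (Y.inl x) = C.toFun (ψ.symm x) shrinkConst := by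
  rw [jYref, lev_inl Θ h₀, bas_inl Θ h₀]
  simp

include h₁ in
/-- **The far end goes to the boundary of `W`.** [folklore] -/
theorem jYref_inr (x : M) : jYref C ψ Θ (Y.inr x) = b.incl (ψ.symm x) := by
  rw [jYref, lev_inr Θ h₁, bas_inr Θ h₁]
  simp [C.apply_zero]

include h₀ in
/-- A point of level `0` lies on the incoming end. [folklore] -/
theorem eq_inl_of_lev_eq_zero {y : Y.W} (hy : lev Θ y = 0) : y = Y.inl (bas Θ y) := by
  have h : Θ.symm (bas Θ y, ⊥) = Y.inl (bas Θ y) := by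
    rw [← h₀ (bas Θ y), Diffeomorph.symm_apply_apply]
  rw [← h]
  conv_lhs => rw [← symm_bas_lev Θ y]
  congr 2
  exact Subtype.ext (by rw [Set.Icc.coe_bot]; exact hy)

include h₁ in
/-- A point of level `1` lies on the far end. [folklore] -/
theorem eq_inr_of_lev_eq_one {y : Y.W} (hy : lev Θ y = 1) : y = Y.inr (bas Θ y) := by
  have h : Θ.symm (bas Θ y, ⊤) = Y.inr (bas Θ y) := by
    rw [← h₁ (bas Θ y), Diffeomorph.symm_apply_apply]
  rw [← h]
  conv_lhs => rw [← symm_bas_lev Θ y]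
  congr 2
  exact Subtype.ext (by rw [Set.Icc.coe_top]; exact hy)

/-- `σ⁻¹` is strictly monotone. [folklore] -/
theorem profile_symm_lt_iff (a c : ℝ) : profile.symm a < profile.symm c ↔ a < c := by
  conv_rhs => rw [← profile.apply_symm_apply a, ← profile.apply_symm_apply c]
  exact profile_lt_profile_iff.symm

/-! #### The three partial diffeomorphisms -/

variable [IsManifold (𝓡 (n + 1)) ∞ M]

/-- **The slab homeomorphism**: `Y - inl M ≅ {w ∈ region | height w < c}`, `y ↦ jY y`, inverse
`w ↦ Θ⁻¹ (ψ (proj w), 1 - height w / c)`. [folklore] -/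
def slabHomeo : OpenPartialHomeomorph Y.W W where
  toFun := jYref C ψ Θ
  invFun w := Θ.symm (ψ (C.proj w), Set.projIcc 0 1 zero_le_one (1 - C.height w / shrinkConst))
  source := {y | 0 < lev Θ y}
  target := C.region ∩ C.height ⁻¹' Iio shrinkConst
  map_source' y hy := by
    refine ⟨jYref_mem_region C ψ Θ y, ?_⟩
    show C.height (jYref C ψ Θ y) < shrinkConst
    rw [height_jYref]
    have : 0 < lev Θ y := hy
    nlinarith [shrinkConst_pos]
  map_target' w hw := by
    obtain ⟨hw1, hw2⟩ := hw
    have hh : 0 ≤ C.height w := C.height_nonneg w hw1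
    have hh' : C.height w < shrinkConst := hw2
    have hmem : 1 - C.height w / shrinkConst ∈ Icc (0 : ℝ) 1 := by
      constructor
      · rw [sub_nonneg, div_le_one shrinkConst_pos]; exact hh'.le
      · linarith [div_nonneg hh shrinkConst_pos.le]
    show 0 < lev Θ _
    simp only [lev, Diffeomorph.apply_symm_apply, Set.projIcc_of_mem _ hmem]
    have : C.height w / shrinkConst < 1 := (div_lt_one shrinkConst_pos).2 hh'
    linarith
  left_inv' y hy := by
    have hp := param_nonneg Θ y
    simp only [jYref, C.proj_apply _ _ hp, C.height_apply _ _ hp, Diffeomorph.apply_symm_apply]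
    have hc : shrinkConst ≠ 0 := shrinkConst_pos.ne'
    have : 1 - shrinkConst * (1 - lev Θ y) / shrinkConst = lev Θ y := by
      field_simp
      ring
    rw [this, Set.projIcc_of_mem _ (lev_mem Θ y)]
    exact symm_bas_lev Θ y
  right_inv' w hw := by
    obtain ⟨hw1, hw2⟩ := hw
    have hh : 0 ≤ C.height w := C.height_nonneg w hw1
    have hh' : C.height w < shrinkConst := hw2
    have hmem : 1 - C.height w / shrinkConst ∈ Icc (0 : ℝ) 1 := by
      constructor
      · rw [sub_nonneg, div_le_one shrinkConst_pos]; exact hh'.le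
      · linarith [div_nonneg hh shrinkConst_pos.le]
    simp only [jYref, bas, lev, Diffeomorph.apply_symm_apply, Set.projIcc_of_mem _ hmem,
      Diffeomorph.symm_apply_apply]
    have hc : shrinkConst ≠ 0 := shrinkConst_pos.ne'
    have : shrinkConst * (1 - (1 - C.height w / shrinkConst)) = C.height w := by
      field_simp
      ring
    rw [this]
    exact C.apply_proj_height w hw1
  open_source := isOpen_lt continuous_const (continuous_lev Θ)
  open_target := C.continuousOn_height.isOpen_inter_preimage C.isOpen_region isOpen_Iio
  continuousOn_toFun := (continuous_jYref C ψ Θ).continuousOn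
  continuousOn_invFun := by
    refine Θ.symm.continuous.comp_continuousOn ?_
    refine (ψ.continuous.comp_continuousOn (C.continuousOn_proj.mono inter_subset_left)).prodMk ?_
    exact continuous_projIcc.comp_continuousOn
      ((continuousOn_const.sub ((C.continuousOn_height.mono inter_subset_left).div_const _)))

/-- The slab homeomorphism is the upside-down piece (definitional). [folklore] -/
theorem slabHomeo_apply (y : Y.W) : slabHomeo C ψ Θ y = jYref C ψ Θ y := rfl

/-- The source of the slab homeomorphism (definitional). [folklore] -/
theorem slabHomeo_source : (slabHomeo C ψ Θ).source = {y | 0 < lev Θ y} := rfl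

/-- The slab homeomorphism is `C^∞`. [folklore] -/
theorem contMDiffOn_slabHomeo :
    ContMDiffOn (𝓡∂ (n + 1 + 1)) (𝓡∂ (n + 1 + 1)) ∞ (slabHomeo C ψ Θ) (slabHomeo C ψ Θ).source :=
  (contMDiff_jYref C ψ Θ).contMDiffOn

/-- The inverse of the slab homeomorphism is `C^∞`. [folklore] -/
theorem contMDiffOn_slabHomeo_symm :
    ContMDiffOn (𝓡∂ (n + 1 + 1)) (𝓡∂ (n + 1 + 1)) ∞ (slabHomeo C ψ Θ).symm (slabHomeo C ψ Θ).target := by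
  have h1 : ContMDiffOn (𝓡∂ (n + 1 + 1)) (𝓡 (n + 1)) ∞ (fun w => ψ (C.proj w)) (slabHomeo C ψ Θ).target :=
    ψ.contMDiff.comp_contMDiffOn (C.contMDiffOn_proj.mono inter_subset_left)
  have h2 : ContMDiffOn (𝓡∂ (n + 1 + 1)) 𝓘(ℝ, ℝ) ∞ (fun w => 1 - C.height w / shrinkConst)
      (slabHomeo C ψ Θ).target :=
    contMDiffOn_const.sub ((C.contMDiffOn_height.mono inter_subset_left).div_const _)
  have h3 : ContMDiffOn (𝓡∂ (n + 1 + 1)) (𝓡∂ 1) ∞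
      (fun w => Set.projIcc (0 : ℝ) 1 zero_le_one (1 - C.height w / shrinkConst))
      (slabHomeo C ψ Θ).target := by
    refine (contMDiffOn_projIcc (x := (0 : ℝ)) (y := 1) (n := ∞)).comp h2 fun w hw => ?_
    obtain ⟨hw1, hw2⟩ := hw
    have hh : 0 ≤ C.height w := C.height_nonneg w hw1
    have hh' : C.height w < shrinkConst := hw2
    constructor
    · rw [sub_nonneg, div_le_one shrinkConst_pos]; exact hh'.le
    · linarith [div_nonneg hh shrinkConst_pos.le]
  exact Θ.symm.contMDiff.comp_contMDiffOn (h1.prodMk h3)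

/-- **The foot homeomorphism**: `Y - inr M ≅ {w ∈ region | height w < σ⁻¹ (2c)}`,
`y ↦ C (ψ⁻¹ pr₁Θy) (σ⁻¹ (c (1 + pr₂Θy)))`, so that `shrink ∘ footHomeo` is the upside-down
piece reflected in the level `c`. [folklore] -/
def footHomeo : OpenPartialHomeomorph Y.W W where
  toFun y := C.toFun (ψ.symm (bas Θ y)) (profile.symm (shrinkConst * (1 + lev Θ y)))
  invFun w := Θ.symm (ψ (C.proj w),
    Set.projIcc 0 1 zero_le_one (profile (C.height w) / shrinkConst - 1))
  source := {y | lev Θ y < 1}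
  target := C.region ∩ C.height ⁻¹' Iio (profile.symm (2 * shrinkConst))
  map_source' y hy := by
    have hy' : lev Θ y < 1 := hy
    have hs : 0 ≤ profile.symm (shrinkConst * (1 + lev Θ y)) := by
      rw [profile_symm_nonneg_iff]
      nlinarith [shrinkConst_pos, lev_nonneg Θ y]
    refine ⟨C.mem_region _ _ hs, ?_⟩
    show C.height _ < _
    rw [C.height_apply _ _ hs, profile_symm_lt_iff]
    nlinarith [shrinkConst_pos]
  map_target' w hw := by
    obtain ⟨hw1, hw2⟩ := hw
    have hh : 0 ≤ C.height w := C.height_nonneg w hw1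
    have hh' : C.height w < profile.symm (2 * shrinkConst) := hw2
    have hσ : shrinkConst ≤ profile (C.height w) := shrinkConst_le_profile hh
    have hσ' : profile (C.height w) < 2 * shrinkConst := by
      have := profile_lt_profile_iff.2 hh'
      rwa [Homeomorph.apply_symm_apply] at this
    have hmem : profile (C.height w) / shrinkConst - 1 ∈ Icc (0 : ℝ) 1 := by
      have hlo : (1 : ℝ) ≤ profile (C.height w) / shrinkConst := (one_le_div shrinkConst_pos).2 hσ
      have hhi : profile (C.height w) / shrinkConst ≤ 2 := by
        rw [div_le_iff₀ shrinkConst_pos]; linarith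
      constructor <;> linarith
    show lev Θ _ < 1
    simp only [lev, Diffeomorph.apply_symm_apply, Set.projIcc_of_mem _ hmem]
    rw [sub_lt_iff_lt_add, div_lt_iff₀ shrinkConst_pos]; linarith
  left_inv' y hy := by
    have hs : 0 ≤ profile.symm (shrinkConst * (1 + lev Θ y)) := by
      rw [profile_symm_nonneg_iff]
      nlinarith [shrinkConst_pos, lev_nonneg Θ y]
    simp only [C.proj_apply _ _ hs, C.height_apply _ _ hs, Diffeomorph.apply_symm_apply,
      Homeomorph.apply_symm_apply]
    have hc : shrinkConst ≠ 0 := shrinkConst_pos.ne'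
    have : shrinkConst * (1 + lev Θ y) / shrinkConst - 1 = lev Θ y := by
      field_simp
      ring
    rw [this, Set.projIcc_of_mem _ (lev_mem Θ y)]
    exact symm_bas_lev Θ y
  right_inv' w hw := by
    obtain ⟨hw1, hw2⟩ := hw
    have hh : 0 ≤ C.height w := C.height_nonneg w hw1
    have hh' : C.height w < profile.symm (2 * shrinkConst) := hw2
    have hσ : shrinkConst ≤ profile (C.height w) := shrinkConst_le_profile hh
    have hσ' : profile (C.height w) < 2 * shrinkConst := by
      have := profile_lt_profile_iff.2 hh'
      rwa [Homeomorph.apply_symm_apply] at this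
    have hmem : profile (C.height w) / shrinkConst - 1 ∈ Icc (0 : ℝ) 1 := by
      have hlo : (1 : ℝ) ≤ profile (C.height w) / shrinkConst := (one_le_div shrinkConst_pos).2 hσ
      have hhi : profile (C.height w) / shrinkConst ≤ 2 := by
        rw [div_le_iff₀ shrinkConst_pos]; linarith
      constructor <;> linarith
    simp only [bas, lev, Diffeomorph.apply_symm_apply, Set.projIcc_of_mem _ hmem,
      Diffeomorph.symm_apply_apply]
    have hc : shrinkConst ≠ 0 := shrinkConst_pos.ne'
    have : shrinkConst * (1 + (profile (C.height w) / shrinkConst - 1)) = profile (C.height w) := by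
      field_simp
      ring
    rw [this, Homeomorph.symm_apply_apply]
    exact C.apply_proj_height w hw1
  open_source := isOpen_lt (continuous_lev Θ) continuous_const
  open_target := C.continuousOn_height.isOpen_inter_preimage C.isOpen_region isOpen_Iio
  continuousOn_toFun := by
    refine Continuous.continuousOn ?_
    have h1 : Continuous fun y => (ψ.symm (bas Θ y), profile.symm (shrinkConst * (1 + lev Θ y))) :=
      (ψ.symm.continuous.comp (continuous_bas Θ)).prodMk
        (profile.symm.continuous.comp (continuous_const.mul (continuous_const.add (continuous_lev Θ))))
    refine C.continuousOn_toFun.comp_continuous h1 fun y => ⟨mem_univ _, ?_⟩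
    show 0 ≤ profile.symm (shrinkConst * (1 + lev Θ y))
    rw [profile_symm_nonneg_iff]
    nlinarith [shrinkConst_pos, lev_nonneg Θ y]
  continuousOn_invFun := by
    refine Θ.symm.continuous.comp_continuousOn ?_
    refine (ψ.continuous.comp_continuousOn (C.continuousOn_proj.mono inter_subset_left)).prodMk ?_
    exact continuous_projIcc.comp_continuousOn
      (((profile.continuous.comp_continuousOn (C.continuousOn_height.mono inter_subset_left)).div_const
        _).sub continuousOn_const)

/-- The foot homeomorphism (definitional). [folklore] -/
theorem footHomeo_apply (y : Y.W) :
    footHomeo C ψ Θ y = C.toFun (ψ.symm (bas Θ y)) (profile.symm (shrinkConst * (1 + lev Θ y))) := rfl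

/-- The source of the foot homeomorphism (definitional). [folklore] -/
theorem footHomeo_source : (footHomeo C ψ Θ).source = {y | lev Θ y < 1} := rfl

/-- The foot homeomorphism is `C^∞`. [folklore] -/
theorem contMDiffOn_footHomeo :
    ContMDiffOn (𝓡∂ (n + 1 + 1)) (𝓡∂ (n + 1 + 1)) ∞ (footHomeo C ψ Θ) (footHomeo C ψ Θ).source := by
  have h1 : ContMDiff (𝓡∂ (n + 1 + 1)) ((𝓡 (n + 1)).prod 𝓘(ℝ, ℝ)) ∞
      (fun y => (ψ.symm (bas Θ y), profile.symm (shrinkConst * (1 + lev Θ y)))) :=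
    (ψ.symm.contMDiff.comp (contMDiff_bas Θ)).prodMk
      (contMDiff_profile_symm.comp (contMDiff_const.mul (contMDiff_const.add (contMDiff_lev Θ))))
  refine (C.contMDiffOn_toFun.comp_contMDiff h1 fun y => ⟨mem_univ _, ?_⟩).contMDiffOn
  show 0 ≤ profile.symm (shrinkConst * (1 + lev Θ y))
  rw [profile_symm_nonneg_iff]
  nlinarith [shrinkConst_pos, lev_nonneg Θ y]

/-- The inverse of the foot homeomorphism is `C^∞`. [folklore] -/
theorem contMDiffOn_footHomeo_symm :
    ContMDiffOn (𝓡∂ (n + 1 + 1)) (𝓡∂ (n + 1 + 1)) ∞ (footHomeo C ψ Θ).symm (footHomeo C ψ Θ).target := by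
  have h1 : ContMDiffOn (𝓡∂ (n + 1 + 1)) (𝓡 (n + 1)) ∞ (fun w => ψ (C.proj w)) (footHomeo C ψ Θ).target :=
    ψ.contMDiff.comp_contMDiffOn (C.contMDiffOn_proj.mono inter_subset_left)
  have h2 : ContMDiffOn (𝓡∂ (n + 1 + 1)) 𝓘(ℝ, ℝ) ∞
      (fun w => profile (C.height w) / shrinkConst - 1) (footHomeo C ψ Θ).target :=
    ((contMDiff_profile.comp_contMDiffOn (C.contMDiffOn_height.mono inter_subset_left)).div_const
      _).sub contMDiffOn_const
  have h3 : ContMDiffOn (𝓡∂ (n + 1 + 1)) (𝓡∂ 1) ∞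
      (fun w => Set.projIcc (0 : ℝ) 1 zero_le_one (profile (C.height w) / shrinkConst - 1))
      (footHomeo C ψ Θ).target := by
    refine (contMDiffOn_projIcc (x := (0 : ℝ)) (y := 1) (n := ∞)).comp h2 fun w hw => ?_
    obtain ⟨hw1, hw2⟩ := hw
    have hh : 0 ≤ C.height w := C.height_nonneg w hw1
    have hh' : C.height w < profile.symm (2 * shrinkConst) := hw2
    have hσ : shrinkConst ≤ profile (C.height w) := shrinkConst_le_profile hh
    have hσ' : profile (C.height w) < 2 * shrinkConst := by
      have := profile_lt_profile_iff.2 hh'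
      rwa [Homeomorph.apply_symm_apply] at this
    have hlo : (1 : ℝ) ≤ profile (C.height w) / shrinkConst := (one_le_div shrinkConst_pos).2 hσ
    have hhi : profile (C.height w) / shrinkConst ≤ 2 := by
      rw [div_le_iff₀ shrinkConst_pos]; linarith
    constructor <;> linarith
  exact Θ.symm.contMDiff.comp_contMDiffOn (h1.prodMk h3)

omit [IsManifold (𝓡 (n + 1)) ∞ M] in
/-- **The reflection of the open collar in the level `c`**: `C x t ↦ C x (2c - t)` on
`{0 < height < 2c}`. [folklore] -/
def reflHomeo : OpenPartialHomeomorph W W where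
  toFun w := C.toFun (C.proj w) (2 * shrinkConst - C.height w)
  invFun w := C.toFun (C.proj w) (2 * shrinkConst - C.height w)
  source := C.region ∩ C.height ⁻¹' Ioo 0 (2 * shrinkConst)
  target := C.region ∩ C.height ⁻¹' Ioo 0 (2 * shrinkConst)
  map_source' w hw := by
    obtain ⟨hw1, hw2⟩ := hw
    have h2 : C.height w ∈ Ioo 0 (2 * shrinkConst) := hw2
    have hs : 0 ≤ 2 * shrinkConst - C.height w := by linarith [h2.2]
    refine ⟨C.mem_region _ _ hs, ?_⟩
    show C.height (C.toFun (C.proj w) (2 * shrinkConst - C.height w)) ∈ Ioo 0 (2 * shrinkConst)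
    rw [C.height_apply _ _ hs]
    exact ⟨by linarith [h2.2], by linarith [h2.1]⟩
  map_target' w hw := by
    obtain ⟨hw1, hw2⟩ := hw
    have h2 : C.height w ∈ Ioo 0 (2 * shrinkConst) := hw2
    have hs : 0 ≤ 2 * shrinkConst - C.height w := by linarith [h2.2]
    refine ⟨C.mem_region _ _ hs, ?_⟩
    show C.height (C.toFun (C.proj w) (2 * shrinkConst - C.height w)) ∈ Ioo 0 (2 * shrinkConst)
    rw [C.height_apply _ _ hs]
    exact ⟨by linarith [h2.2], by linarith [h2.1]⟩
  left_inv' w hw := by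
    obtain ⟨hw1, hw2⟩ := hw
    have h2 : C.height w ∈ Ioo 0 (2 * shrinkConst) := hw2
    have hs : 0 ≤ 2 * shrinkConst - C.height w := by linarith [h2.2]
    simp only [C.proj_apply _ _ hs, C.height_apply _ _ hs, sub_sub_cancel]
    exact C.apply_proj_height w hw1
  right_inv' w hw := by
    obtain ⟨hw1, hw2⟩ := hw
    have h2 : C.height w ∈ Ioo 0 (2 * shrinkConst) := hw2
    have hs : 0 ≤ 2 * shrinkConst - C.height w := by linarith [h2.2]
    simp only [C.proj_apply _ _ hs, C.height_apply _ _ hs, sub_sub_cancel]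
    exact C.apply_proj_height w hw1
  open_source := C.continuousOn_height.isOpen_inter_preimage C.isOpen_region isOpen_Ioo
  open_target := C.continuousOn_height.isOpen_inter_preimage C.isOpen_region isOpen_Ioo
  continuousOn_toFun := by
    refine C.continuousOn_toFun.comp ((C.continuousOn_proj.mono inter_subset_left).prodMk
      (continuousOn_const.sub (C.continuousOn_height.mono inter_subset_left))) fun w hw => ?_
    have h2 : C.height w ∈ Ioo 0 (2 * shrinkConst) := hw.2
    exact ⟨mem_univ _, by show 0 ≤ 2 * shrinkConst - C.height w; linarith [h2.2]⟩
  continuousOn_invFun := by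
    refine C.continuousOn_toFun.comp ((C.continuousOn_proj.mono inter_subset_left).prodMk
      (continuousOn_const.sub (C.continuousOn_height.mono inter_subset_left))) fun w hw => ?_
    have h2 : C.height w ∈ Ioo 0 (2 * shrinkConst) := hw.2
    exact ⟨mem_univ _, by show 0 ≤ 2 * shrinkConst - C.height w; linarith [h2.2]⟩

omit [IsManifold (𝓡 (n + 1)) ∞ M] in
/-- The reflection is `C^∞`. [folklore] -/
theorem contMDiffOn_reflHomeo :
    ContMDiffOn (𝓡∂ (n + 1 + 1)) (𝓡∂ (n + 1 + 1)) ∞ (reflHomeo C) (reflHomeo C).source := by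
  refine C.contMDiffOn_toFun.comp ((C.contMDiffOn_proj.mono inter_subset_left).prodMk
    (contMDiffOn_const.sub (C.contMDiffOn_height.mono inter_subset_left))) fun w hw => ?_
  have h2 : C.height w ∈ Ioo 0 (2 * shrinkConst) := hw.2
  exact ⟨mem_univ _, by show 0 ≤ 2 * shrinkConst - C.height w; linarith [h2.2]⟩

omit [IsManifold (𝓡 (n + 1)) ∞ M] in
/-- The inverse of the reflection (the reflection itself) is `C^∞`. [folklore] -/
theorem contMDiffOn_reflHomeo_symm :
    ContMDiffOn (𝓡∂ (n + 1 + 1)) (𝓡∂ (n + 1 + 1)) ∞ (reflHomeo C).symm (reflHomeo C).target :=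
  contMDiffOn_reflHomeo C

variable [T2Space W] [IsManifold (𝓡∂ (n + 1 + 1)) ∞ W] [CompactSpace W]

/-! #### The pushed-in piece `W` -/

/-- **The pushed-in piece**: the shrink map of the collar over the whole boundary. [folklore] -/
def jWref (w : W) : W := C.shrink univ w

/-- The pushed-in piece is a smooth embedding (`CollarShrink.isSmoothEmbedding_shrinkTo`
composed with the inclusion of the open submanifold `W - ∂W`). [folklore] -/
theorem isImmersionAtOfComplement_jWref (w : W) :
    Manifold.IsImmersionAtOfComplement PUnit.{1} (𝓡∂ (n + 1 + 1)) (𝓡∂ (n + 1 + 1)) ∞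
      (jWref C) w := by
  haveI : CompactSpace b.carrier := b.compactSpace_carrier
  have hK : IsCompact (univ : Set b.carrier) := isCompact_univ
  have h1 : Manifold.IsSmoothEmbedding (𝓡∂ (n + 1 + 1)) (𝓡∂ (n + 1 + 1)) ∞
      (C.shrinkTo univ hK) := C.isSmoothEmbedding_shrinkTo univ isOpen_univ hK
  have h2 : Manifold.IsImmersionAtOfComplement PUnit.{1} (𝓡∂ (n + 1 + 1)) (𝓡∂ (n + 1 + 1)) ∞
      (C.shrinkTo univ hK) w := h1.isImmersionAtOfComplement_punit rfl w
  have hne : Nonempty (b.away (univ : Set b.carrier)) := ⟨C.shrinkTo univ hK w⟩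
  set c := (b.away (univ : Set b.carrier)).openPartialHomeomorphSubtypeCoe hne with hc
  have h3 := postcomp_openPartialHomeomorph h2 c (contMDiffOn_subtypeCoe _ hne)
    (contMDiffOn_subtypeCoe_symm _ hne) (by simp [hc])
  refine h3.congr_of_eventuallyEq (Filter.Eventually.of_forall fun z => ?_)
  show C.shrink univ z = c (C.shrinkTo univ hK z)
  simp [hc]

/-- **The pushed-in piece is a smooth embedding.** [folklore] -/
theorem isSmoothEmbedding_jWref :
    Manifold.IsSmoothEmbedding (𝓡∂ (n + 1 + 1)) (𝓡∂ (n + 1 + 1)) ∞ (jWref C) := by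
  haveI : CompactSpace b.carrier := b.compactSpace_carrier
  exact ⟨Manifold.IsImmersionOfComplement.isImmersion fun w => isImmersionAtOfComplement_jWref C w,
    (C.isClosedEmbedding_shrink univ isOpen_univ isCompact_univ).isEmbedding⟩

omit [T2Space W] [IsManifold (𝓡∂ (n + 1 + 1)) ∞ W] [CompactSpace W] in
/-- **The upside-down piece near the incoming end**: `jY = refl ∘ shrink ∘ foot` on
`{pr₂ Θ < 1}` (indeed everywhere, as an identity of total functions). [folklore] -/
theorem jYref_eq_refl_shrink_foot (y : Y.W) :
    jYref C ψ Θ y = reflHomeo C (jWref C (footHomeo C ψ Θ y)) := by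
  have hs : 0 ≤ profile.symm (shrinkConst * (1 + lev Θ y)) := by
    rw [profile_symm_nonneg_iff]
    nlinarith [shrinkConst_pos, lev_nonneg Θ y]
  have ht : 0 ≤ shrinkConst * (1 + lev Θ y) := by nlinarith [shrinkConst_pos, lev_nonneg Θ y]
  rw [footHomeo_apply, jWref, C.shrink_toFun univ (mem_univ _) hs, Homeomorph.apply_symm_apply]
  show _ = C.toFun (C.proj (C.toFun _ _)) (2 * shrinkConst - C.height (C.toFun _ _))
  rw [C.proj_apply _ _ ht, C.height_apply _ _ ht, jYref]
  congr 1
  ring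

omit [T2Space W] [IsManifold (𝓡∂ (n + 1 + 1)) ∞ W] [CompactSpace W] in
/-- Off the far end, `shrink ∘ foot` lands in the domain of the reflection. [folklore] -/
theorem jWref_footHomeo_mem {y : Y.W} (hy : lev Θ y < 1) :
    jWref C (footHomeo C ψ Θ y) ∈ (reflHomeo C).source := by
  have hs : 0 ≤ profile.symm (shrinkConst * (1 + lev Θ y)) := by
    rw [profile_symm_nonneg_iff]
    nlinarith [shrinkConst_pos, lev_nonneg Θ y]
  have ht : 0 ≤ shrinkConst * (1 + lev Θ y) := by nlinarith [shrinkConst_pos, lev_nonneg Θ y]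
  rw [footHomeo_apply, jWref, C.shrink_toFun univ (mem_univ _) hs, Homeomorph.apply_symm_apply]
  refine ⟨C.mem_region _ _ ht, ?_⟩
  show C.height _ ∈ Ioo 0 (2 * shrinkConst)
  rw [C.height_apply _ _ ht]
  constructor <;> nlinarith [shrinkConst_pos, lev_nonneg Θ y]

/-- **The upside-down piece is an immersion at every point** (complement `PUnit`). [folklore] -/
theorem isImmersionAtOfComplement_jYref (y : Y.W) :
    Manifold.IsImmersionAtOfComplement PUnit.{1} (𝓡∂ (n + 1 + 1)) (𝓡∂ (n + 1 + 1)) ∞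
      (jYref C ψ Θ) y := by
  by_cases hy : 0 < lev Θ y
  · -- off the incoming end: the slab homeomorphism
    have h0 : Manifold.IsImmersionAtOfComplement PUnit.{1} (𝓡∂ (n + 1 + 1)) (𝓡∂ (n + 1 + 1)) ∞
        (id : W → W) (slabHomeo C ψ Θ y) := Manifold.IsImmersionOfComplement.id _
    have h1 := h0.comp_openPartialHomeomorph (slabHomeo C ψ Θ) (contMDiffOn_slabHomeo C ψ Θ)
      (contMDiffOn_slabHomeo_symm C ψ Θ) (show y ∈ (slabHomeo C ψ Θ).source from hy)
    exact h1
  · -- near the incoming end: reflection ∘ shrink ∘ foot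
    have hy1 : lev Θ y < 1 := by linarith [lev_nonneg Θ y]
    have h0 : Manifold.IsImmersionAtOfComplement PUnit.{1} (𝓡∂ (n + 1 + 1)) (𝓡∂ (n + 1 + 1)) ∞
        (jWref C) (footHomeo C ψ Θ y) := isImmersionAtOfComplement_jWref C _
    have h1 := h0.comp_openPartialHomeomorph (footHomeo C ψ Θ) (contMDiffOn_footHomeo C ψ Θ)
      (contMDiffOn_footHomeo_symm C ψ Θ) (show y ∈ (footHomeo C ψ Θ).source from hy1)
    have h2 := postcomp_openPartialHomeomorph h1 (reflHomeo C) (contMDiffOn_reflHomeo C)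
      (contMDiffOn_reflHomeo_symm C) (jWref_footHomeo_mem C ψ Θ hy1)
    refine h2.congr_of_eventuallyEq ?_
    filter_upwards [(footHomeo C ψ Θ).open_source.mem_nhds (show y ∈ _ from hy1)] with y' hy'
    exact (jYref_eq_refl_shrink_foot C ψ Θ y').symm

/-- **The upside-down piece is a smooth embedding.** [folklore] -/
theorem isSmoothEmbedding_jYref :
    Manifold.IsSmoothEmbedding (𝓡∂ (n + 1 + 1)) (𝓡∂ (n + 1 + 1)) ∞ (jYref C ψ Θ) :=
  ⟨Manifold.IsImmersionOfComplement.isImmersion fun y => isImmersionAtOfComplement_jYref C ψ Θ y,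
    ((continuous_jYref C ψ Θ).isClosedEmbedding (injective_jYref C ψ Θ)).isEmbedding⟩

/-! #### The attachment -/

omit [IsManifold (𝓡 (n + 1)) ∞ M] [T2Space W] [IsManifold (𝓡∂ (n + 1 + 1)) ∞ W] [CompactSpace W] in
include h₁ in
/-- The far end of the upside-down piece is `incl ∘ ψ⁻¹`. [folklore] -/
theorem jYref_comp_inr : jYref C ψ Θ ∘ Y.inr = b.incl ∘ ψ.symm := by
  funext m
  exact jYref_inr C ψ Θ h₁ m

omit [T2Space W] [IsManifold (𝓡∂ (n + 1 + 1)) ∞ W] [CompactSpace W] in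
include h₁ in
/-- The far end of the upside-down piece is a smooth embedding. [folklore] -/
theorem isSmoothEmbedding_jYref_comp_inr :
    Manifold.IsSmoothEmbedding (𝓡 (n + 1)) (𝓡∂ (n + 1 + 1)) ∞ (jYref C ψ Θ ∘ Y.inr) := by
  rw [jYref_comp_inr C ψ Θ h₁]
  exact b.isSmoothEmbedding.comp_diffeomorph ψ.symm

omit [IsManifold (𝓡 (n + 1)) ∞ M] [T2Space W] [IsManifold (𝓡∂ (n + 1 + 1)) ∞ W] [CompactSpace W] in
include h₁ in
/-- The far end of the upside-down piece is the boundary of `W`. [folklore] -/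
theorem range_jYref_comp_inr : range (jYref C ψ Θ ∘ Y.inr) = (𝓡∂ (n + 1 + 1)).boundary W := by
  rw [jYref_comp_inr C ψ Θ h₁, range_comp]
  have : range (ψ.symm : M → b.carrier) = univ := ψ.symm.surjective.range_eq
  rw [this, image_univ, b.range_incl]

omit [IsManifold (𝓡 (n + 1)) ∞ M] [T2Space W] [IsManifold (𝓡∂ (n + 1 + 1)) ∞ W] [CompactSpace W] in
/-- Every point of `W` lies in one of the two pieces. [folklore] -/
theorem range_jWref_union_range_jYref : range (jWref C) ∪ range (jYref C ψ Θ) = univ := by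
  refine eq_univ_of_forall fun w => ?_
  rcases C.mem_range_shrink_or univ w with h | ⟨x, -, t, ht0, htc, rfl⟩
  · exact Or.inl h
  · right
    have hmem : 1 - t / shrinkConst ∈ Icc (0 : ℝ) 1 := by
      constructor
      · rw [sub_nonneg, div_le_one shrinkConst_pos]; exact htc.le
      · linarith [div_nonneg ht0 shrinkConst_pos.le]
    refine ⟨Θ.symm (ψ x, ⟨1 - t / shrinkConst, hmem⟩), ?_⟩
    simp only [jYref, bas, lev, Diffeomorph.apply_symm_apply, Diffeomorph.symm_apply_apply]
    congr 1
    have hc : shrinkConst ≠ 0 := shrinkConst_pos.ne'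
    field_simp
    ring

omit [IsManifold (𝓡 (n + 1)) ∞ M] [T2Space W] [IsManifold (𝓡∂ (n + 1 + 1)) ∞ W] [CompactSpace W] in
include h₀ in
/-- **The two pieces meet exactly along `∂W ≡_ψ inl (M)`.** [folklore] -/
theorem jWref_eq_jYref_iff (w : W) (y : Y.W) :
    jWref C w = jYref C ψ Θ y ↔ ∃ z, w = b.incl z ∧ y = Y.inl (ψ z) := by
  constructor
  · intro h
    -- the common point has height `≥ c` (as a shrunk point) and `≤ c` (as an upside-down point)
    have hmem : jYref C ψ Θ y ∈ range (C.shrink univ) := ⟨w, h⟩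
    have hlev : lev Θ y = 0 := by
      by_contra hne
      have hpos : 0 < lev Θ y := lt_of_le_of_ne (lev_nonneg Θ y) (Ne.symm hne)
      have hlt : shrinkConst * (1 - lev Θ y) < shrinkConst := by nlinarith [shrinkConst_pos]
      exact C.toFun_not_mem_range_shrink univ (mem_univ _) (param_nonneg Θ y) hlt hmem
    have hy : y = Y.inl (bas Θ y) := eq_inl_of_lev_eq_zero Θ h₀ hlev
    refine ⟨ψ.symm (bas Θ y), ?_, by rw [Diffeomorph.apply_symm_apply]; exact hy⟩
    apply C.shrink_injective univ
    show jWref C w = _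
    rw [h, C.shrink_incl univ (mem_univ _), hy, jYref_inl C ψ Θ h₀, bas_inl Θ h₀]
  · rintro ⟨z, rfl, rfl⟩
    show C.shrink univ (b.incl z) = _
    rw [C.shrink_incl univ (mem_univ _), jYref_inl C ψ Θ h₀, Diffeomorph.symm_apply_apply]

/-- **`W` is a witness of `W ∪_ψ Y` for a product cobordism `Y` (relative to both ends), with
far end the boundary of `W` marked through `ψ⁻¹`.** [cite: MilnorHCobordism1965, §1, Thm. 1.4] -/
def referenceAttachment : CobordismAttachment b Y ψ W where
  jW := jWref C
  jX := jYref C ψ Θ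
  isSmoothEmbedding_jW := isSmoothEmbedding_jWref C
  isSmoothEmbedding_jX := isSmoothEmbedding_jYref C ψ Θ
  range_union := range_jWref_union_range_jYref C ψ Θ
  jW_eq_jX_iff := jWref_eq_jYref_iff C ψ Θ h₀
  isSmoothEmbedding_jX_comp_inr := isSmoothEmbedding_jYref_comp_inr C ψ Θ h₁
  range_jX_comp_inr := range_jYref_comp_inr C ψ Θ h₁

/-- **The far end of the reference attachment is `incl ∘ ψ⁻¹`.** [folklore] -/
theorem referenceAttachment_jX_inr (m : M) :
    (referenceAttachment C ψ Θ h₀ h₁).jX (Y.inr m) = b.incl (ψ.symm m) :=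
  jYref_inr C ψ Θ h₁ m

/-- **Existence form.** For a compact manifold with boundary `W` (with nonempty boundary), a
product cobordism `Y` relative to both ends and `ψ : ∂W ≅ M`, there is a witness of `W ∪_ψ Y`
on `W` itself whose far end is `incl ∘ ψ⁻¹`. [cite: MilnorHCobordism1965, §1, Thm. 1.4] -/
theorem exists_referenceAttachment [Nonempty b.carrier] {Y : Cobordism (n + 1) M M}
    (hY : Y.IsTrivialRelEnds) (ψ : b.carrier ≃ₘ⟮𝓡 (n + 1), 𝓡 (n + 1)⟯ M) :
    ∃ A : CobordismAttachment b Y ψ W, ∀ m, A.jX (Y.inr m) = b.incl (ψ.symm m) := by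
  obtain ⟨Θ, h₀, h₁⟩ := hY
  obtain ⟨C⟩ := b.nonempty_openCollar
  exact ⟨referenceAttachment C ψ Θ h₀ h₁, referenceAttachment_jX_inr C ψ Θ h₀ h₁⟩

end Reference

end CobordismAttachment

end Literature.Topology.FourManifolds

end
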